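import Literature.MathematicalPhysics.QuantumFieldTheory.Balaban1983to89.B9QLettersAtPinsL2
import Literature.MathematicalPhysics.QuantumFieldTheory.Balaban1983to89.B9Thm313WholeQstarFromG0

/-!
# `Balaban1983to89.B9LettersZQstarFieldsAtPinsL2` — [B9] Theorems 3.12–3.13 (pp. 420–426), the block-L² lines (3.46): EVERY
# BLOCK-L² `Q*`- AND `Q`-COMPOSITE LETTER FIELD OF THE ROWS-20–21 PAIR SCHEMAS (`Letters313L2PZ(c).gQs ∕ dGQs ∕ ddGQs ∕ q`,
# `Letters313L2MZ.dGQsd`) AT THE N06 CERTIFICATE'S PINS — every member, every `Reg335` configuration above the transfer threshold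

T. Bałaban, *Propagators for lattice gauge theories in a background field*, Commun. Math. Phys. **99** (1985) 389–434
[`Balaban1985BackgroundPropagators`, "B9"]; [4] = T. Bałaban, *Propagators and renormalization transformations for lattice gauge
theories. II*, Commun. Math. Phys. **96** (1984) 223–250 [`Balaban1984PropagatorsII`]; [3] = part I, Commun. Math. Phys. **95** (1984) 17–40
[`Balaban1984PropagatorsI`].

statement-level skeleton of published theorems with citation tags; proofs where landed; nothing here is a claim about the Yang–Mills
mass gap

THE PRINT.  (3.46) p. 398 (the six block-L² lines of Theorem 3.3), (3.153) p. 426 (the reduction of 𝔊 to G₁, G′, (QG₁Q\*)⁻¹), (3.110) p. 417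
(the averaging operator Q); p. 398 remark after (3.47) (one scale factor Lʲη may be traded between the two blocks).  The block-L² pair
schemas of rows 20–21 (`B9Thm313WholeL2GPZ.Letters313L2PZ`, re-cut `B9Thm313WholeLettersCut.Letters313L2Pc`, and the direction form
`B9Thm313WholeDirL2Z.Letters313L2MZ`) display the composites `G₀Q*`, `∇_UG₀Q*`, `∇_ν∇_μG₀Q*`, `∇_{U,ν}G₀Q*` and the operator `Q` in block-L²,
the coarse side weighted by `v_Z = √(n⁻¹)`.

THE POINT (cell `pub-ymgap`, node N06 [B9]; width seat w5, the (c2) «derive route», block-L² half; sup ∕ probe half =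
`B9LettersZQstarFieldsAtPins`).  Each composite is dag-n06-l's `B9Thm313WholeQstarFromG0.gQs_l2_of_l0 ∕ dGQs_l2_of_l1 ∕ ddGQs_l2_of_l3`
applied to a (3.46) line of the G₀ layer the certificate DERIVES (`Thm33G0L2P.l0 ∕ l1 ∕ l3`, `Thm33G0L2M.l1d` — HYPOTHESES here) and to this
base's block-L² `Q*`-letter `B9QstarLettersAtPinsL2.blockBd_Qstar_pins_len` (kernel `L·e^{(δ_Q+ε)(ℓ+4)}·(len y)⁻¹·(v_Z·len)(y′)·e^{−δ_Qd}` above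
the member threshold `log L ≤ ε(2L²−1)M`); the `Q` line is `B9QLettersAtPinsL2.blockBd_Q_pins_len` read through the pins.  Member level, FIELD
BY FIELD, conclusions = the schema fields VERBATIM over generic Sect.-D letters `𝔬` with the pins as equations:
* ★★ `gQs_l2_pins` (`Letters313L2PZ(c).gQs`), ★★ `dGQs_l2_pins` (`.dGQs`), ★★ `dGQsd_l2_pins` (`Letters313L2MZ.dGQsd ν`),
  ★★ `ddGQs_l2_pins` (`.ddGQs q`) — any `B₄ ≥ B₂·L·e^{(δ_Q+ε)(ℓ+4)}·c`, rates `0 ≤ ρ ≤ δ₁`, `ρ + σ ≤ δ_Q`;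
* ★ `q_l2_pins` (`Letters313L2PZ(c).q`) — any `B₄ ≥ L·e^{(δ_Q+ε)(ℓ+4)}`, rate `ρ ≤ δ_Q`.
KNIT (dag-n06-d, an edition after ED.38∕39, owner's call): `(hLL2 …).1.gQs ↦ gQs_l2_pins x (hβ1 x) hU hrow hB12₂ hδQ hε (hM…) hρ hρ₁ hρQ hB₄
(hblk12 x) (hblkZ12 x) (hQsco12 x U) (hG0C x …).2.2.l0`, etc.; the displayed pair binder then keeps only its `gDv ∕ dGDv ∕ rgdI ∕ rgdDs ∕ c1`
(re-cut: `vDRDG ∕ vGDRD`) fields; the member threshold `log L ≤ ε(2L²−1)M` is dag-n06-w3's `B9Letters313AtOneQ.transfer_threshold` at `p = 1`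
(`log(ℓ+1)∕ε ≤ M`).

HONEST SCOPE.  By-name compositions of landed producer files (p609187, p611666, dag-n06-l's `B9Thm313WholeQstarFromG0`); the G₀-layer block-L²
lines and the row-sum letter are HYPOTHESES of each theorem; nothing of [B9]'s Theorems 3.3 ∕ 3.12 ∕ 3.13 is asserted; COUNT-NEUTRAL; N06 is
NOT discharged; one finite lattice at a time; nothing continuum, nothing about the mass gap ∕ Clay.  Cell `pub-ymgap` (HUMAN RULING D-0062 ∕
D-0154), Track A node N06 [B9], width seat `pub-ymgap-dag-n06-w5` (g3), 2026-08-28.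
-/

noncomputable section

namespace Literature.MathematicalPhysics.QuantumFieldTheory.Balaban1983to89.B9LettersZQstarFieldsAtPinsL2

open scoped Matrix.Norms.L2Operator
open Node00 B6GlobalChartV1 B6KLevelCensusIndexV1
open B6Geom246MultiLevelTorus (geomT)
open B6Ineq2142KLevelV1 (β lvl)
open B7Prop2SpecialUnitary (specialUnitaryUnits)
open B9PinMembersKLevelV1 (MemberY geo9Y bg9Y)
open B9CoReadingCoordsTranspose (TrIdx trBasis)
open B9CoReadingCoords (XBK blkBK)
open B9CoReadingCoordsH (XHK blkHK)
open B9GeoNormsKLevelV1 (geo9K geo9K_dist_nonneg)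
open B9GeoLemma21KLevelV1 (geo9Y_dist_triangle geo9Y_dist_comm geo9Y_len_pos geo9K_one_le_L)
open B9Thm34Ext (toB6)
open B9SectDL2Decay (BlockBd)
open B11SectG (RowSum)
open B9Thm312Whole (Ops GeoOK)
open Node00.OpsYSectDCoords (QscoKH QcoKH)
open B9QstarLettersAtPinsL2 (blockBd_Qstar_pins_len)
open B9QLettersAtPinsL2 (blockBd_Q_pins_len)
open B9Thm313WholeQstarFromG0 (gQs_l2_of_l0 dGQs_l2_of_l1 ddGQs_l2_of_l3)

variable {d ℓ : ℕ} {hd : 1 ≤ d + 1} {hL : Odd (ℓ + 1) ∧ 1 < ℓ + 1} {b₀ b₁ : ℝ} {Mstar : ℕ} {N : ℕ} [NeZero N]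
variable [∀ x : MemberY d ℓ hd hL b₀ b₁ Mstar, Fintype (geo9Y x).Site]

/-! ## §1 `G₀Q*` in block-L² -/

/-- ★★ **`G₀Q*` IN BLOCK-L² AT THE PINS** — the field `Letters313L2PZ.gQs` = `Letters313L2Pc.gQs`
(`‖1_{Δ(y)}G₀Q*μ‖₂ ≤ B₄·Lʲη(y)·(v_Z·Lʲη)(y′)·e^{−ρd(y,y′)}‖1_{Δ(y′)}μ‖₂`), every member above the transfer threshold `log L ≤ ε(2L²−1)M`, every
`Reg335` `U`: from the (3.46)₀ line of `G₀` (`hl0`, the G₀ layer's `Thm33G0L2P.l0` — HYPOTHESIS), this base's block-L² `Q*`-letter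
`blockBd_Qstar_pins_len` at rate `δ_Q` and dag-n06-l's `gQs_l2_of_l0`; any `B₄ ≥ B₂·(L·e^{(δ_Q+ε)(ℓ+4)})·c`, rates `0 ≤ ρ ≤ δ₁`, `ρ + σ ≤ δ_Q`.
[cite: Balaban1985BackgroundPropagators, (3.153) p.426 + (3.46) p.398 + (3.110) p.417 + p.398 (remark after (3.47)); Balaban1984PropagatorsII, (2.26) p.228 + Lemma 2.1 (2.61) p.234; Balaban1984PropagatorsI, (1.18) p.20] -/
theorem gQs_l2_pins (x : MemberY d ℓ hd hL b₀ b₁ Mstar) {bI : FBondY x.toKIdx → IBondY x.toKIdx}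
    (hβ1 : ∀ f : FBondY x.toKIdx, (geomT x.D).dist (β x.hN x.D x.hk (bI f)) (blkV1 x.hN x.D f) ≤ 1)
    {Y W : Type} [Fintype Y] [Fintype W]
    {𝔬 : Ops (geo9Y x) (bg9Y (Matrix (Fin N) (Fin N) ℂ) (specialUnitaryUnits (Fin N)) x) (XBK (TrIdx N) x.toKIdx) Y (XHK (TrIdx N) x.toKIdx) W}
    {H : Prop} {B₂ δ₁ σ c ρ δQ ε B₄ c35 α₀ : ℝ}
    {U : (bg9Y (Matrix (Fin N) (Fin N) ℂ) (specialUnitaryUnits (Fin N)) x).Cfg}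
    (hU : (bg9Y (Matrix (Fin N) (Fin N) ℂ) (specialUnitaryUnits (Fin N)) x).Reg335 c35 α₀ U)
    (hrow : RowSum (toB6 (geo9Y x) 1 H) σ c) (hB₂ : 0 ≤ B₂) (hδQ : 0 ≤ δQ) (hε : 0 < ε)
    (hM : Real.log (geo9Y x).L ≤ ε * (2 * ((ℓ : ℝ) + 1) ^ 2 - 1) * (geo9Y x).M)
    (hρ : 0 ≤ ρ) (hρ₁ : ρ ≤ δ₁) (hρQ : ρ + σ ≤ δQ)
    (hB₄ : B₂ * ((geo9Y x).L * Real.exp ((δQ + ε) * ((ℓ : ℝ) + 4))) * c ≤ B₄)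
    (hblk : 𝔬.blk = blkBK x.toKIdx bI) (hblkZ : 𝔬.blkZ = blkHK x.toKIdx)
    (hQs : 𝔬.Qstar U = QscoKH x.toKIdx (trBasis N) (bg9Y (Matrix (Fin N) (Fin N) ℂ) (specialUnitaryUnits (Fin N)) x) (fun U => U) (parBY x.toKIdx) U)
    (hl0 : BlockBd (g := toB6 (geo9Y x) 1 H) 𝔬.blk 𝔬.blk (𝔬.G0 U)
      (fun (y y' : (geo9Y x).Site) => B₂ * (geo9Y x).len y * (geo9Y x).len y' * Real.exp (-(δ₁ * (geo9Y x).dist y y')))) :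
    BlockBd (g := toB6 (geo9Y x) 1 H) 𝔬.blkZ 𝔬.blk (𝔬.G0 U ∘ₗ 𝔬.Qstar U)
      (fun (y y' : (geo9Y x).Site) => B₄ * (geo9Y x).len y *
        (Real.sqrt (((((ℓ + 1 : ℕ) : ℝ) ^ (d + 1)) ^ lvl x.hN x.D x.hk y')⁻¹) * (geo9Y x).len y') * Real.exp (-(ρ * (geo9Y x).dist y y'))) := by
  letI : Fintype (geo9K x.toKIdx).Site := (inferInstance : Fintype (geo9Y x).Site)
  have hG : GeoOK (geo9Y x) := ⟨geo9Y_dist_triangle x, geo9Y_dist_comm x, geo9K_dist_nonneg x.toKIdx, geo9Y_len_pos x⟩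
  have hqsL2 := blockBd_Qstar_pins_len x hβ1 hU hδQ hε hM (1 : ℝ) H
  rw [← hblkZ, ← hblk, ← hQs] at hqsL2
  have hBQ : 0 ≤ (geo9Y x).L * Real.exp ((δQ + ε) * ((ℓ : ℝ) + 4)) :=
    mul_nonneg (zero_le_one.trans (geo9K_one_le_L x.toKIdx)) (Real.exp_nonneg _)
  exact gQs_l2_of_l0 hG hrow (fun y => Real.sqrt_nonneg _) hB₂ hBQ hρ hρ₁ hρQ hB₄ hl0 hqsL2

/-! ## §2 `∇_UG₀Q*` and `∇_{U,ν}G₀Q*` in block-L² -/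

/-- ★★ **`∇_UG₀Q*` IN BLOCK-L² AT THE PINS** — the field `Letters313L2PZ.dGQs` = `Letters313L2Pc.dGQs`
(`‖1_{Δ(y)}∇_UG₀Q*μ‖₂ ≤ B₄·(v_Z·Lʲη)(y′)·e^{−ρd}‖1_{Δ(y′)}μ‖₂`), every member above the transfer threshold, every `Reg335` `U`: from the (3.46)₁ line
of `∇_UG₀` (`hl1`, the G₀ layer's `Thm33G0L2P.l1` — HYPOTHESIS), `blockBd_Qstar_pins_len` and dag-n06-l's `dGQs_l2_of_l1`; any
`B₄ ≥ B₂·(L·e^{(δ_Q+ε)(ℓ+4)})·c`, rates `0 ≤ ρ ≤ δ₁`, `ρ + σ ≤ δ_Q`.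
[cite: Balaban1985BackgroundPropagators, (3.153) p.426 + (3.46) p.398 + (3.110) p.417; Balaban1984PropagatorsII, (2.26) p.228 + Lemma 2.1 (2.61) p.234; Balaban1984PropagatorsI, (1.18) p.20] -/
theorem dGQs_l2_pins (x : MemberY d ℓ hd hL b₀ b₁ Mstar) {bI : FBondY x.toKIdx → IBondY x.toKIdx}
    (hβ1 : ∀ f : FBondY x.toKIdx, (geomT x.D).dist (β x.hN x.D x.hk (bI f)) (blkV1 x.hN x.D f) ≤ 1)
    {Y W : Type} [Fintype Y] [Fintype W]
    {𝔬 : Ops (geo9Y x) (bg9Y (Matrix (Fin N) (Fin N) ℂ) (specialUnitaryUnits (Fin N)) x) (XBK (TrIdx N) x.toKIdx) Y (XHK (TrIdx N) x.toKIdx) W}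
    {H : Prop} {B₂ δ₁ σ c ρ δQ ε B₄ c35 α₀ : ℝ}
    {U : (bg9Y (Matrix (Fin N) (Fin N) ℂ) (specialUnitaryUnits (Fin N)) x).Cfg}
    (hU : (bg9Y (Matrix (Fin N) (Fin N) ℂ) (specialUnitaryUnits (Fin N)) x).Reg335 c35 α₀ U)
    (hrow : RowSum (toB6 (geo9Y x) 1 H) σ c) (hB₂ : 0 ≤ B₂) (hδQ : 0 ≤ δQ) (hε : 0 < ε)
    (hM : Real.log (geo9Y x).L ≤ ε * (2 * ((ℓ : ℝ) + 1) ^ 2 - 1) * (geo9Y x).M)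
    (hρ : 0 ≤ ρ) (hρ₁ : ρ ≤ δ₁) (hρQ : ρ + σ ≤ δQ)
    (hB₄ : B₂ * ((geo9Y x).L * Real.exp ((δQ + ε) * ((ℓ : ℝ) + 4))) * c ≤ B₄)
    (hblk : 𝔬.blk = blkBK x.toKIdx bI) (hblkZ : 𝔬.blkZ = blkHK x.toKIdx)
    (hQs : 𝔬.Qstar U = QscoKH x.toKIdx (trBasis N) (bg9Y (Matrix (Fin N) (Fin N) ℂ) (specialUnitaryUnits (Fin N)) x) (fun U => U) (parBY x.toKIdx) U)
    (hl1 : BlockBd (g := toB6 (geo9Y x) 1 H) 𝔬.blk 𝔬.blkY (𝔬.D U ∘ₗ 𝔬.G0 U)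
      (fun (y y' : (geo9Y x).Site) => B₂ * (geo9Y x).len y' * Real.exp (-(δ₁ * (geo9Y x).dist y y')))) :
    BlockBd (g := toB6 (geo9Y x) 1 H) 𝔬.blkZ 𝔬.blkY (𝔬.D U ∘ₗ 𝔬.G0 U ∘ₗ 𝔬.Qstar U)
      (fun (y y' : (geo9Y x).Site) => B₄ *
        (Real.sqrt (((((ℓ + 1 : ℕ) : ℝ) ^ (d + 1)) ^ lvl x.hN x.D x.hk y')⁻¹) * (geo9Y x).len y') * Real.exp (-(ρ * (geo9Y x).dist y y'))) := by
  letI : Fintype (geo9K x.toKIdx).Site := (inferInstance : Fintype (geo9Y x).Site)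
  have hG : GeoOK (geo9Y x) := ⟨geo9Y_dist_triangle x, geo9Y_dist_comm x, geo9K_dist_nonneg x.toKIdx, geo9Y_len_pos x⟩
  have hqsL2 := blockBd_Qstar_pins_len x hβ1 hU hδQ hε hM (1 : ℝ) H
  rw [← hblkZ, ← hblk, ← hQs] at hqsL2
  have hBQ : 0 ≤ (geo9Y x).L * Real.exp ((δQ + ε) * ((ℓ : ℝ) + 4)) :=
    mul_nonneg (zero_le_one.trans (geo9K_one_le_L x.toKIdx)) (Real.exp_nonneg _)
  exact dGQs_l2_of_l1 hG hrow (fun y => Real.sqrt_nonneg _) hB₂ hBQ hρ hρ₁ hρQ hB₄ hl1 hqsL2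

/-- ★★ **`∇_{U,ν}G₀Q*` IN BLOCK-L² AT THE PINS, EVERY DIRECTION `ν`** — the field `Letters313L2MZ.dGQsd ν`
(`‖1_{Δ(y)}∇_{U,ν}G₀Q*μ‖₂ ≤ B₄·(v_Z·Lʲη)(y′)·e^{−ρd}‖1_{Δ(y′)}μ‖₂`), every member above the transfer threshold, every `Reg335` `U`: from the direction
lines of `∇_{U,ν}G₀` (`hl1d`, the G₀ layer's `Thm33G0L2M.l1d` — HYPOTHESIS), `blockBd_Qstar_pins_len` and dag-n06-l's `dGQs_l2_of_l1` at `E := ∇_{U,ν}`;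
any `B₄ ≥ B₂·(L·e^{(δ_Q+ε)(ℓ+4)})·c`, rates `0 ≤ ρ ≤ δ₁`, `ρ + σ ≤ δ_Q`.
[cite: Balaban1985BackgroundPropagators, (3.153) p.426 + (3.46) p.398 + (3.110) p.417 + Thm 3.13 p.426; Balaban1984PropagatorsII, (2.26) p.228 + Lemma 2.1 (2.61) p.234; Balaban1984PropagatorsI, (1.18) p.20] -/
theorem dGQsd_l2_pins (x : MemberY d ℓ hd hL b₀ b₁ Mstar) {bI : FBondY x.toKIdx → IBondY x.toKIdx}
    (hβ1 : ∀ f : FBondY x.toKIdx, (geomT x.D).dist (β x.hN x.D x.hk (bI f)) (blkV1 x.hN x.D f) ≤ 1)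
    {Y W P : Type} [Fintype Y] [Fintype W]
    {𝔬 : Ops (geo9Y x) (bg9Y (Matrix (Fin N) (Fin N) ℂ) (specialUnitaryUnits (Fin N)) x) (XBK (TrIdx N) x.toKIdx) Y (XHK (TrIdx N) x.toKIdx) W}
    {Dd : (bg9Y (Matrix (Fin N) (Fin N) ℂ) (specialUnitaryUnits (Fin N)) x).Cfg → P → Module.End ℝ (XBK (TrIdx N) x.toKIdx → ℝ)}
    {H : Prop} {B₂ δ₁ σ c ρ δQ ε B₄ c35 α₀ : ℝ}
    {U : (bg9Y (Matrix (Fin N) (Fin N) ℂ) (specialUnitaryUnits (Fin N)) x).Cfg}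
    (hU : (bg9Y (Matrix (Fin N) (Fin N) ℂ) (specialUnitaryUnits (Fin N)) x).Reg335 c35 α₀ U)
    (hrow : RowSum (toB6 (geo9Y x) 1 H) σ c) (hB₂ : 0 ≤ B₂) (hδQ : 0 ≤ δQ) (hε : 0 < ε)
    (hM : Real.log (geo9Y x).L ≤ ε * (2 * ((ℓ : ℝ) + 1) ^ 2 - 1) * (geo9Y x).M)
    (hρ : 0 ≤ ρ) (hρ₁ : ρ ≤ δ₁) (hρQ : ρ + σ ≤ δQ)
    (hB₄ : B₂ * ((geo9Y x).L * Real.exp ((δQ + ε) * ((ℓ : ℝ) + 4))) * c ≤ B₄)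
    (hblk : 𝔬.blk = blkBK x.toKIdx bI) (hblkZ : 𝔬.blkZ = blkHK x.toKIdx)
    (hQs : 𝔬.Qstar U = QscoKH x.toKIdx (trBasis N) (bg9Y (Matrix (Fin N) (Fin N) ℂ) (specialUnitaryUnits (Fin N)) x) (fun U => U) (parBY x.toKIdx) U)
    (hl1d : ∀ ν : P, BlockBd (g := toB6 (geo9Y x) 1 H) 𝔬.blk 𝔬.blk (Dd U ν ∘ₗ 𝔬.G0 U)
      (fun (y y' : (geo9Y x).Site) => B₂ * (geo9Y x).len y' * Real.exp (-(δ₁ * (geo9Y x).dist y y')))) :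
    ∀ ν : P, BlockBd (g := toB6 (geo9Y x) 1 H) 𝔬.blkZ 𝔬.blk (Dd U ν ∘ₗ 𝔬.G0 U ∘ₗ 𝔬.Qstar U)
      (fun (y y' : (geo9Y x).Site) => B₄ *
        (Real.sqrt (((((ℓ + 1 : ℕ) : ℝ) ^ (d + 1)) ^ lvl x.hN x.D x.hk y')⁻¹) * (geo9Y x).len y') * Real.exp (-(ρ * (geo9Y x).dist y y'))) := by
  letI : Fintype (geo9K x.toKIdx).Site := (inferInstance : Fintype (geo9Y x).Site)
  have hG : GeoOK (geo9Y x) := ⟨geo9Y_dist_triangle x, geo9Y_dist_comm x, geo9K_dist_nonneg x.toKIdx, geo9Y_len_pos x⟩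
  have hqsL2 := blockBd_Qstar_pins_len x hβ1 hU hδQ hε hM (1 : ℝ) H
  rw [← hblkZ, ← hblk, ← hQs] at hqsL2
  have hBQ : 0 ≤ (geo9Y x).L * Real.exp ((δQ + ε) * ((ℓ : ℝ) + 4)) :=
    mul_nonneg (zero_le_one.trans (geo9K_one_le_L x.toKIdx)) (Real.exp_nonneg _)
  intro ν
  exact dGQs_l2_of_l1 hG hrow (fun y => Real.sqrt_nonneg _) hB₂ hBQ hρ hρ₁ hρQ hB₄ (hl1d ν) hqsL2

/-! ## §3 `∇_ν∇_μG₀Q*` in block-L² -/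

/-- ★★ **`∇_ν∇_μG₀Q*` IN BLOCK-L² AT THE PINS, EVERY PAIR `q = (ν, μ)`** — the field `Letters313L2PZ.ddGQs q` = `Letters313L2Pc.ddGQs q`
(`‖1_{Δ(y)}∇_ν∇_μG₀Q*μ'‖₂ ≤ B₄·(Lʲη(y))⁻¹·(v_Z·Lʲη)(y′)·e^{−ρd}‖1_{Δ(y′)}μ'‖₂`), every member above the transfer threshold, every `Reg335` `U`: from the
(3.46)₃ lines of `∇_ν∇_μG₀` (`hl3`, the G₀ layer's `Thm33G0L2P.l3` — HYPOTHESIS), `blockBd_Qstar_pins_len` and dag-n06-l's `ddGQs_l2_of_l3`; any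
`B₄ ≥ B₂·(L·e^{(δ_Q+ε)(ℓ+4)})·c`, rates `0 ≤ ρ ≤ δ₁`, `ρ + σ ≤ δ_Q`.
[cite: Balaban1985BackgroundPropagators, (3.153) p.426 + (3.46) p.398 + (3.110) p.417 + Thm 3.13 p.426; Balaban1984PropagatorsII, (2.26) p.228 + Lemma 2.1 (2.61) p.234; Balaban1984PropagatorsI, (1.18) p.20] -/
theorem ddGQs_l2_pins (x : MemberY d ℓ hd hL b₀ b₁ Mstar) {bI : FBondY x.toKIdx → IBondY x.toKIdx}
    (hβ1 : ∀ f : FBondY x.toKIdx, (geomT x.D).dist (β x.hN x.D x.hk (bI f)) (blkV1 x.hN x.D f) ≤ 1)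
    {Y W P : Type} [Fintype Y] [Fintype W]
    {𝔬 : Ops (geo9Y x) (bg9Y (Matrix (Fin N) (Fin N) ℂ) (specialUnitaryUnits (Fin N)) x) (XBK (TrIdx N) x.toKIdx) Y (XHK (TrIdx N) x.toKIdx) W}
    {Dd : (bg9Y (Matrix (Fin N) (Fin N) ℂ) (specialUnitaryUnits (Fin N)) x).Cfg → P → Module.End ℝ (XBK (TrIdx N) x.toKIdx → ℝ)}
    {H : Prop} {B₂ δ₁ σ c ρ δQ ε B₄ c35 α₀ : ℝ}
    {U : (bg9Y (Matrix (Fin N) (Fin N) ℂ) (specialUnitaryUnits (Fin N)) x).Cfg}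
    (hU : (bg9Y (Matrix (Fin N) (Fin N) ℂ) (specialUnitaryUnits (Fin N)) x).Reg335 c35 α₀ U)
    (hrow : RowSum (toB6 (geo9Y x) 1 H) σ c) (hB₂ : 0 ≤ B₂) (hδQ : 0 ≤ δQ) (hε : 0 < ε)
    (hM : Real.log (geo9Y x).L ≤ ε * (2 * ((ℓ : ℝ) + 1) ^ 2 - 1) * (geo9Y x).M)
    (hρ : 0 ≤ ρ) (hρ₁ : ρ ≤ δ₁) (hρQ : ρ + σ ≤ δQ)
    (hB₄ : B₂ * ((geo9Y x).L * Real.exp ((δQ + ε) * ((ℓ : ℝ) + 4))) * c ≤ B₄)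
    (hblk : 𝔬.blk = blkBK x.toKIdx bI) (hblkZ : 𝔬.blkZ = blkHK x.toKIdx)
    (hQs : 𝔬.Qstar U = QscoKH x.toKIdx (trBasis N) (bg9Y (Matrix (Fin N) (Fin N) ℂ) (specialUnitaryUnits (Fin N)) x) (fun U => U) (parBY x.toKIdx) U)
    (hl3 : ∀ q : P × P, BlockBd (g := toB6 (geo9Y x) 1 H) 𝔬.blk 𝔬.blk ((Dd U q.1 ∘ₗ Dd U q.2) ∘ₗ 𝔬.G0 U)
      (fun (y y' : (geo9Y x).Site) => B₂ * (((geo9Y x).len y)⁻¹ * (geo9Y x).len y') * Real.exp (-(δ₁ * (geo9Y x).dist y y')))) :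
    ∀ q : P × P, BlockBd (g := toB6 (geo9Y x) 1 H) 𝔬.blkZ 𝔬.blk ((Dd U q.1 ∘ₗ Dd U q.2) ∘ₗ 𝔬.G0 U ∘ₗ 𝔬.Qstar U)
      (fun (y y' : (geo9Y x).Site) => B₄ * (((geo9Y x).len y)⁻¹ *
        (Real.sqrt (((((ℓ + 1 : ℕ) : ℝ) ^ (d + 1)) ^ lvl x.hN x.D x.hk y')⁻¹) * (geo9Y x).len y')) * Real.exp (-(ρ * (geo9Y x).dist y y'))) := by
  letI : Fintype (geo9K x.toKIdx).Site := (inferInstance : Fintype (geo9Y x).Site)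
  have hG : GeoOK (geo9Y x) := ⟨geo9Y_dist_triangle x, geo9Y_dist_comm x, geo9K_dist_nonneg x.toKIdx, geo9Y_len_pos x⟩
  have hqsL2 := blockBd_Qstar_pins_len x hβ1 hU hδQ hε hM (1 : ℝ) H
  rw [← hblkZ, ← hblk, ← hQs] at hqsL2
  have hBQ : 0 ≤ (geo9Y x).L * Real.exp ((δQ + ε) * ((ℓ : ℝ) + 4)) :=
    mul_nonneg (zero_le_one.trans (geo9K_one_le_L x.toKIdx)) (Real.exp_nonneg _)
  intro q
  exact ddGQs_l2_of_l3 hG hrow (fun y => Real.sqrt_nonneg _) hB₂ hBQ hρ hρ₁ hρQ hB₄ (hl3 q) hqsL2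

/-! ## §4 The averaging operator `Q` in block-L² -/

/-- ★ **`Q(U)` IN BLOCK-L² AT THE PINS, RE-LETTERED TO THE SCHEMA KERNEL** — the field `Letters313L2PZ.q` = `Letters313L2Pc.q`
(`‖1_{Δ(y)}Q(U)F‖₂ ≤ B₄·(v_Z·Lʲη)(y)·(Lʲη(y′))⁻¹·e^{−ρd}‖1_{Δ(y′)}F‖₂`), every member above the transfer threshold, every `Reg335` `U`: this base's
`B9QLettersAtPinsL2.blockBd_Q_pins_len` (kernel `L·e^{(δ_Q+ε)(ℓ+4)}·(…)·e^{−δ_Qd}`) read through the pins `hblk`, `hblkZ`, `hQ : 𝔬.Q U = QcoKH … U` and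
weakened to any `B₄ ≥ L·e^{(δ_Q+ε)(ℓ+4)}` and any rate `ρ ≤ δ_Q`.
[cite: Balaban1985BackgroundPropagators, (3.110) p.417 + (3.46) p.398 + (3.153) p.426 + (3.13) p.393; Balaban1984PropagatorsI, (1.18) p.20] -/
theorem q_l2_pins (x : MemberY d ℓ hd hL b₀ b₁ Mstar) {bI : FBondY x.toKIdx → IBondY x.toKIdx}
    (hβ1 : ∀ f : FBondY x.toKIdx, (geomT x.D).dist (β x.hN x.D x.hk (bI f)) (blkV1 x.hN x.D f) ≤ 1)
    {Y W : Type} [Fintype Y] [Fintype W]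
    {𝔬 : Ops (geo9Y x) (bg9Y (Matrix (Fin N) (Fin N) ℂ) (specialUnitaryUnits (Fin N)) x) (XBK (TrIdx N) x.toKIdx) Y (XHK (TrIdx N) x.toKIdx) W}
    {H : Prop} {ρ δQ ε B₄ c35 α₀ : ℝ}
    {U : (bg9Y (Matrix (Fin N) (Fin N) ℂ) (specialUnitaryUnits (Fin N)) x).Cfg}
    (hU : (bg9Y (Matrix (Fin N) (Fin N) ℂ) (specialUnitaryUnits (Fin N)) x).Reg335 c35 α₀ U)
    (hδQ : 0 ≤ δQ) (hε : 0 < ε) (hM : Real.log (geo9Y x).L ≤ ε * (2 * ((ℓ : ℝ) + 1) ^ 2 - 1) * (geo9Y x).M)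
    (hρQ : ρ ≤ δQ) (hB₄ : (geo9Y x).L * Real.exp ((δQ + ε) * ((ℓ : ℝ) + 4)) ≤ B₄)
    (hblk : 𝔬.blk = blkBK x.toKIdx bI) (hblkZ : 𝔬.blkZ = blkHK x.toKIdx)
    (hQ : 𝔬.Q U = QcoKH x.toKIdx (trBasis N) (bg9Y (Matrix (Fin N) (Fin N) ℂ) (specialUnitaryUnits (Fin N)) x) (fun U => U) (parBY x.toKIdx) U) :
    BlockBd (g := toB6 (geo9Y x) 1 H) 𝔬.blk 𝔬.blkZ (𝔬.Q U)
      (fun (y y' : (geo9Y x).Site) => B₄ * (Real.sqrt (((((ℓ + 1 : ℕ) : ℝ) ^ (d + 1)) ^ lvl x.hN x.D x.hk y)⁻¹) * (geo9Y x).len y *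
        ((geo9Y x).len y')⁻¹) * Real.exp (-(ρ * (geo9Y x).dist y y'))) := by
  letI : Fintype (geo9K x.toKIdx).Site := (inferInstance : Fintype (geo9Y x).Site)
  have hq := blockBd_Q_pins_len x hβ1 hU hδQ hε hM (1 : ℝ) H
  rw [← hblkZ, ← hblk, ← hQ] at hq
  refine hq.mono fun y y' => ?_
  have hd0 : 0 ≤ (geo9Y x).dist y y' := geo9K_dist_nonneg x.toKIdx y y'
  have h1 : Real.exp (-(δQ * (geo9Y x).dist y y')) ≤ Real.exp (-(ρ * (geo9Y x).dist y y')) :=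
    Real.exp_le_exp.mpr (neg_le_neg (mul_le_mul_of_nonneg_right hρQ hd0))
  have hw : 0 ≤ Real.sqrt (((((ℓ + 1 : ℕ) : ℝ) ^ (d + 1)) ^ lvl x.hN x.D x.hk y)⁻¹) * (geo9Y x).len y * ((geo9Y x).len y')⁻¹ :=
    mul_nonneg (mul_nonneg (Real.sqrt_nonneg _) (geo9Y_len_pos x y).le) (inv_nonneg.mpr (geo9Y_len_pos x y').le)
  have h0 : 0 ≤ (geo9Y x).L * Real.exp ((δQ + ε) * ((ℓ : ℝ) + 4)) :=
    mul_nonneg (zero_le_one.trans (geo9K_one_le_L x.toKIdx)) (Real.exp_nonneg _)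
  calc (geo9Y x).L * Real.exp ((δQ + ε) * ((ℓ : ℝ) + 4)) *
        (Real.sqrt (((((ℓ + 1 : ℕ) : ℝ) ^ (d + 1)) ^ lvl x.hN x.D x.hk y)⁻¹) * (geo9Y x).len y * ((geo9Y x).len y')⁻¹) *
          Real.exp (-(δQ * (geo9Y x).dist y y'))
      ≤ (geo9Y x).L * Real.exp ((δQ + ε) * ((ℓ : ℝ) + 4)) *
        (Real.sqrt (((((ℓ + 1 : ℕ) : ℝ) ^ (d + 1)) ^ lvl x.hN x.D x.hk y)⁻¹) * (geo9Y x).len y * ((geo9Y x).len y')⁻¹) *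
          Real.exp (-(ρ * (geo9Y x).dist y y')) := mul_le_mul_of_nonneg_left h1 (mul_nonneg h0 hw)
    _ ≤ B₄ * (Real.sqrt (((((ℓ + 1 : ℕ) : ℝ) ^ (d + 1)) ^ lvl x.hN x.D x.hk y)⁻¹) * (geo9Y x).len y * ((geo9Y x).len y')⁻¹) *
          Real.exp (-(ρ * (geo9Y x).dist y y')) :=
        mul_le_mul_of_nonneg_right (mul_le_mul_of_nonneg_right hB₄ hw) (Real.exp_nonneg _)

end Literature.MathematicalPhysics.QuantumFieldTheory.Balaban1983to89.B9LettersZQstarFieldsAtPinsL2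

end
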